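import Literature.Analysis.FluidPDE.KwonTestFieldCalculus
import Literature.Analysis.FluidPDE.KwonLocalLerayDuality
import Literature.Analysis.FluidPDE.DistributionalPressurePoisson
import HarnessLib

/-!
# Kwon's Lemma 2.5: space–time test fields on `(a,b) × B₁` — uniform supports and the
# divergence test functions `φ div A_{Ψ(t,·)}`

Analysis/FluidPDE file on the discharge path of the named fact
`Literature.Analysis.FluidPDE.kwon2023_velocity_epsilon_regularity`
(`PressureFreeEpsilonRegularity.lean`; H. Kwon, J. Differential Equations (2023) =
arXiv:2104.03160, Thm. 1.4), tenth brick of Lemma 2.5: bookkeeping for the space–time test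
fields `Ξ ∈ C_c^∞((a,b) × B₁; ℝ³)` of the perturbed system when the slice identity
(`KwonSliceMomentum.slice_momentum_identity`) is integrated in time.

* `kwonCyl a b R = (a, b) × B_R` as an `Opens`;
* `exists_radius_lt_one`: all slices of `Ξ` — and of every field supported inside `supp Ξ`, such
  as `∂ₜΞ` and `ΔΞ` (`tsupport_uncurry_laplacian_subset`; for `∂ₜ` the tree's
  `tsupport_uncurry_timeDeriv_subset`) — are supported in one closed ball `B̄_r`, `r < 1` (the
  `x`-shadow of the compact support is a compact subset of the open unit ball);
* `contDiff_uncurry_divergence_slice`: the slice divergence of a jointly smooth field is jointly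
  smooth (`D(F t)(x) = D(uncurry F)(t,x) ∘ inr`);
* `isSpaceTimeTestOn_cutoff_mul_divergence_testPotential_slice`: for `Ψ ∈ C_c^∞((a,b) × U; ℝ³)`
  the scalar field `Θ(t,x) = φ(x) div A_{Ψ(t,·)}(x)` is a space–time test function on
  `(a,b) × B₂` — the test functions at which the weak divergence-free condition of `u` on `Q₂`
  enters Kwon's proof (the gradient terms `∇(φ div A_η)` of the duality identity, `η = ∂ₜΞ(t)`,
  `ΔΞ(t)`).

## Mathlib / tree search

Tree (reused): `contDiff_uncurry_testPotential_slice`, `testPotential_zero` (`KwonTestFieldCalculus`);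
`IsSpaceTimeTestOn.timeDeriv_eq_zero_of_notMem` (`HeatDuhamelBack`), `.hasCompactSupport`,
`.tsupport_subset`, `.mono`; `divergence_eq_traceCLM`; `radialCutoff_eq_zero`. Near-duplicates
avoided: `fderiv_slice_eq_comp_inr` (`InverseFlowDivergence`) and
`tsupport_uncurry_timeDeriv_subset` (`WeakHeatOperatorCutoff`) exist in heavier modules and are
inlined / not restated here. Mathlib: `exists_lt_subset_ball`, `hasFDerivAt_prodMk_right`,
`InnerProductSpace.laplacian_congr_nhds`.

## References

* H. Kwon, J. Differential Equations (2023) = arXiv:2104.03160: proof of Lemma 2.5 (arXiv p. 8).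
  [Kwon2023RolePressure]
-/

noncomputable section

open MeasureTheory Set Function Filter Topology TopologicalSpace Metric InnerProductSpace
  ContinuousLinearMap
open scoped NNReal ENNReal RealInnerProductSpace Convolution Laplacian ContDiff

namespace Literature.Analysis.FluidPDE

namespace Kwon2023

variable {Ξ Ψ : ℝ → EuclideanSpace ℝ (Fin 3) → EuclideanSpace ℝ (Fin 3)} {a b : ℝ}

/-- The open cylinder `(a, b) × B_R` as an open set of space–time. [folklore] -/
def kwonCyl (a b R : ℝ) : Opens (ℝ × EuclideanSpace ℝ (Fin 3)) :=
  ⟨Ioo a b ×ˢ ball (0 : EuclideanSpace ℝ (Fin 3)) R, isOpen_Ioo.prod isOpen_ball⟩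

/-- Unfolding `kwonCyl`. [folklore] -/
@[simp] theorem coe_kwonCyl (a b R : ℝ) :
    ((kwonCyl a b R : Opens (ℝ × EuclideanSpace ℝ (Fin 3))) : Set (ℝ × EuclideanSpace ℝ (Fin 3))) =
      Ioo a b ×ˢ ball (0 : EuclideanSpace ℝ (Fin 3)) R := rfl

/-! ### Uniform spatial support of the slices -/

/-- The support of a slice lies in the `x`-shadow of the space–time support. [folklore] -/
theorem tsupport_slice_subset_image (Ξ : ℝ → EuclideanSpace ℝ (Fin 3) → EuclideanSpace ℝ (Fin 3))
    (t : ℝ) : tsupport (Ξ t) ⊆ Prod.snd '' (tsupport (uncurry Ξ) ∩ {p | p.1 = t}) := by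
  refine closure_minimal (fun x hx => ⟨(t, x), ⟨subset_tsupport _ hx, rfl⟩, rfl⟩) ?_
  have hc : IsClosed (tsupport (uncurry Ξ) ∩ {p : ℝ × EuclideanSpace ℝ (Fin 3) | p.1 = t}) :=
    (isClosed_tsupport _).inter (isClosed_eq continuous_fst continuous_const)
  -- the slice `{p | p.1 = t}` of a closed set maps homeomorphically onto its `x`-shadow
  have : Prod.snd '' (tsupport (uncurry Ξ) ∩ {p | p.1 = t}) =
      (fun x => (t, x)) ⁻¹' tsupport (uncurry Ξ) := by
    ext x
    constructor
    · rintro ⟨⟨s, y⟩, ⟨hy, rfl : s = t⟩, rfl⟩; exact hy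
    · intro hx; exact ⟨(t, x), ⟨hx, rfl⟩, rfl⟩
  rw [this]
  exact (isClosed_tsupport _).preimage (continuous_const.prodMk continuous_id)

/-- **Uniform support radius**: a space–time test field on `(a,b) × B₁` has all its slices — and
the slices of every field supported inside its support, such as `∂ₜΞ` and `ΔΞ` — supported in
one closed ball `B̄_r`, `r < 1`. [folklore] -/
theorem exists_radius_lt_one (hΞ : IsSpaceTimeTestOn (kwonCyl a b 1) Ξ) :
    ∃ r : ℝ, r < 1 ∧ ∀ (Ψ : ℝ → EuclideanSpace ℝ (Fin 3) → EuclideanSpace ℝ (Fin 3)),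
      tsupport (uncurry Ψ) ⊆ tsupport (uncurry Ξ) →
        ∀ t, tsupport (Ψ t) ⊆ closedBall (0 : EuclideanSpace ℝ (Fin 3)) r := by
  set K := Prod.snd '' tsupport (uncurry Ξ) with hK
  have hKc : IsCompact K := hΞ.hasCompactSupport.image continuous_snd
  have hK1 : K ⊆ ball (0 : EuclideanSpace ℝ (Fin 3)) 1 := by
    rintro _ ⟨p, hp, rfl⟩
    exact (hΞ.tsupport_subset hp).2
  obtain ⟨r, hr1, hKr⟩ := exists_lt_subset_ball hKc.isClosed hK1
  refine ⟨r, hr1, fun Ψ hΨ t x hx => ?_⟩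
  obtain ⟨p, ⟨hp, -⟩, rfl⟩ := tsupport_slice_subset_image Ψ t hx
  exact ball_subset_closedBall (hKr ⟨p, hΨ hp, rfl⟩)

/-- The slice Laplacian of a space–time test field is supported inside its support. [folklore] -/
theorem tsupport_uncurry_laplacian_subset (Ξ : ℝ → EuclideanSpace ℝ (Fin 3) → EuclideanSpace ℝ (Fin 3)) :
    tsupport (uncurry fun t => Δ (Ξ t)) ⊆ tsupport (uncurry Ξ) := by
  refine closure_minimal (fun z hz => ?_) (isClosed_tsupport _)
  by_contra hz'
  have h0 : uncurry Ξ =ᶠ[𝓝 z] 0 := notMem_tsupport_iff_eventuallyEq.1 hz'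
  have hc : Continuous fun y : EuclideanSpace ℝ (Fin 3) => (z.1, y) := continuous_const.prodMk continuous_id
  have h1 : Ξ z.1 =ᶠ[𝓝 z.2] fun _ => (0 : EuclideanSpace ℝ (Fin 3)) := (hc.tendsto z.2).eventually h0
  exact hz (by
    show (Δ (Ξ z.1)) z.2 = 0
    rw [(laplacian_congr_nhds h1).eq_of_nhds, InnerProductSpace.laplacian_const, Pi.zero_apply])

/-! ### The divergence test functions `φ · div A_{Ψ(t,·)}` -/

/-- The slice divergence of a jointly smooth space–time field is jointly smooth. [folklore] -/
theorem contDiff_uncurry_divergence_slice {F : ℝ → EuclideanSpace ℝ (Fin 3) → EuclideanSpace ℝ (Fin 3)}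
    (hF : ContDiff ℝ ∞ (uncurry F)) :
    ContDiff ℝ ∞ (uncurry fun t x => VectorCalculus.divergence (F t) x) := by
  have e : uncurry (fun t x => VectorCalculus.divergence (F t) x) = fun p : ℝ × EuclideanSpace ℝ (Fin 3) =>
      traceCLM ((fderiv ℝ (uncurry F) p).comp (inr ℝ ℝ (EuclideanSpace ℝ (Fin 3)))) := by
    funext p
    obtain ⟨t, x⟩ := p
    show VectorCalculus.divergence (F t) x = _
    -- `D(F t)(x) = D(uncurry F)(t, x) ∘ inr` (the tree's `fderiv_slice_eq_comp_inr`, inlined)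
    have hd : DifferentiableAt ℝ (uncurry F) (t, x) := (hF.differentiable (by simp)) _
    rw [divergence_eq_traceCLM, ← (hd.hasFDerivAt.comp x (hasFDerivAt_prodMk_right t x)).fderiv]
    rfl
  rw [e]
  exact traceCLM.contDiff.comp ((hF.fderiv_right (m := ∞) (by exact_mod_cast le_top)).clm_comp contDiff_const)

/-- **The divergence test function of a space–time test field**: for `Ψ ∈ C_c^∞((a,b) × U; ℝ³)`,
`Θ(t, x) = φ(x) div A_{Ψ(t,·)}(x)` is a space–time test function on `(a, b) × B₂` (jointly smooth;
supported in `(time shadow of supp Ψ) × B̄_{7/4}`). These are the test functions at which the weak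
divergence-free condition of `u` on `Q₂` is used in Kwon's Lemma 2.5. [folklore] -/
theorem isSpaceTimeTestOn_cutoff_mul_divergence_testPotential_slice {U : Set (EuclideanSpace ℝ (Fin 3))}
    (hU : IsOpen U)
    (hΨ : IsSpaceTimeTestOn (⟨Ioo a b ×ˢ U, isOpen_Ioo.prod hU⟩ : Opens (ℝ × EuclideanSpace ℝ (Fin 3))) Ψ) :
    IsSpaceTimeTestOn (kwonCyl a b 2)
      (fun t x => kwonCutoff x * VectorCalculus.divergence (testPotential (Ψ t)) x) := by
  have hΨ' : IsSpaceTimeTestOn (⊤ : Opens (ℝ × EuclideanSpace ℝ (Fin 3))) Ψ := hΨ.mono le_top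
  have hsmooth : ContDiff ℝ ∞ (uncurry fun t x => kwonCutoff x *
      VectorCalculus.divergence (testPotential (Ψ t)) x) := by
    have h1 : ContDiff ℝ ∞ fun p : ℝ × EuclideanSpace ℝ (Fin 3) => kwonCutoff p.2 :=
      contDiff_kwonCutoff.comp contDiff_snd
    exact h1.mul (contDiff_uncurry_divergence_slice (contDiff_uncurry_testPotential_slice hΨ'))
  -- support
  have hsub : tsupport (uncurry fun t x => kwonCutoff x * VectorCalculus.divergence (testPotential (Ψ t)) x)
      ⊆ (Prod.fst '' tsupport (uncurry Ψ)) ×ˢ closedBall (0 : EuclideanSpace ℝ (Fin 3)) (7 / 4) := by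
    have hc : IsClosed ((Prod.fst '' tsupport (uncurry Ψ)) ×ˢ
        closedBall (0 : EuclideanSpace ℝ (Fin 3)) (7 / 4)) :=
      (hΨ.hasCompactSupport.image continuous_fst).isClosed.prod isClosed_closedBall
    refine closure_minimal (fun q hq => ?_) hc
    obtain ⟨t, x⟩ := q
    refine ⟨?_, ?_⟩
    · by_contra hnot
      refine hq ?_
      have h0 : Ψ t = 0 := by
        funext y
        by_contra hne
        exact hnot ⟨(t, y), subset_tsupport _ hne, rfl⟩
      show kwonCutoff x * VectorCalculus.divergence (testPotential (Ψ t)) x = 0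
      rw [h0, testPotential_zero]
      simp [VectorCalculus.divergence]
    · rw [mem_closedBall_zero_iff]
      by_contra hlt
      refine hq ?_
      show kwonCutoff x * VectorCalculus.divergence (testPotential (Ψ t)) x = 0
      rw [show kwonCutoff x = 0 from radialCutoff_eq_zero (by norm_num) (by norm_num) (not_le.1 hlt).le,
        zero_mul]
  refine ⟨hsmooth, ?_, ?_⟩
  · exact IsCompact.of_isClosed_subset
      ((hΨ.hasCompactSupport.image continuous_fst).prod (isCompact_closedBall _ _))
      (isClosed_tsupport _) hsub
  · refine hsub.trans (prod_mono ?_ (closedBall_subset_ball (by norm_num)))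
    rintro _ ⟨⟨t, y⟩, hty, rfl⟩
    exact (hΨ.tsupport_subset hty).1

end Kwon2023

end Literature.Analysis.FluidPDE

end
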